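import Summits.RiemannHypothesis.RiemannHypothesis.Theorems.SuzukiStructureFunctionsMuContinuity
import Mathlib.MeasureTheory.Integral.DominatedConvergence
import Mathlib.Analysis.Calculus.ContDiff.Deriv
import HarnessLib

/-!
# SuzukiStructureFunctionsPhiTimeDerivative — Lemma 3.6 WITHOUT Fredholm minors: for `K ∈ C¹(ℝ)` vanishing on
# `(−∞,0]`, the extended solution `φ^ε(t,x)` is differentiable in `t` at every `x` on clean ranges, and `∂_tφ^ε`
# solves Suzuki's differentiated equation (3.20) (column DBR; RH-FREE)

LINE 1 — LABEL: RH-FREE (Fredholm/resolvent analysis on the fixed space `L²(ℝ)` for ANY `C¹` kernel vanishing on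
`(−∞,0]`; no `ζ`, no zeros, no positivity); bears_on LADDER-RH B-D → B-P(P1)/(P3): this is the `t`-regularity input
(Suzuki JFA21 Lemma 3.6, there via Fredholm minors `D(x,y;μ;t)`, `d(μ;t)`) of §3.5's first-order system
(3.20) → (3.25) → (3.30) → Thm. 3.1 (4) — the remaining conjunct of the typed residual
`SuzukiStructure.Suzuki2021_thm31_dynamics`. Road (minors-free): the difference `φ^ε(s,·) − φ^ε(t,·)` solves the
window equation at time `s` with right-hand side `(s−t)G(s,·)`, `G` jointly continuous; see §24 below.
WHAT THIS IS NOT: not progress toward RH; (3.25), (3.30) and Thm. 3.1 (4) themselves are NOT proved here; for kernels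
that are only piecewise `C¹` ((K4) with `Λ ≠ ∅`) nothing is claimed.

Source: M. Suzuki, J. Funct. Anal. 281 (2021) 109116 = arXiv:1606.05726 [Suzuki2021Hamiltonians], §3.4 Lemma 3.6,
§3.5 eq. (3.20), eqs. (3.7)–(3.8).

Contents (seat rh-dbr-eng-5 g7): affine substitutions, `suzukiPhiExt_neg_self`, **`suzukiPhiExt_sub_eq`** (difference
equation), `continuous_uncurry_diffQuotKernel`, **`exists_slope_suzukiPhiExt`**, **`hasDerivAt_suzukiPhiExt`** (Lemma 3.6,
`K ∈ C¹`), `deriv_suzukiPhiExt_eq` ((3.20)).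
-/

noncomputable section

-- D-0017: `Summit.<S>.<S>.…` is the designed namespace of a single-problem summit.
set_option linter.dupNamespace false

open MeasureTheory Set Filter Topology Function
open scoped ENNReal RealInnerProductSpace

namespace Summit.RiemannHypothesis.RiemannHypothesis.Theorems.SuzukiStructureFunctions

open Literature.Analysis.OperatorTheory Literature.NumberTheory.LFunctions
  Literature.NumberTheory.LFunctions.SuzukiStructure
open Summit.RiemannHypothesis.RiemannHypothesis.Theorems.SuzukiPhiExistence
  (continuous_suzukiPhiExt setIntegral_Iic_kernel_mul_suzukiPhiExt_eq exists_isSuzukiPhiSolution_of_noUnitEigenvalue)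

variable {K : ℝ → ℝ} {ε t : ℝ}

/-! ## §24 Lemma 3.6 WITHOUT Fredholm minors: `t`-differentiability of `φ^ε(t,x)` for `K ∈ C¹` by the resolvent road

For `s, t` clean, the difference `D = φ^ε(s,·) − φ^ε(t,·)` solves the window equation AT TIME `s` with right-hand side
`(s−t)·G(s,x)`, where `G` is a jointly continuous function built from `K′`, `K` and `φ^ε(t,·)` (three elementary
substitutions `u = t + θ(s−t)`, `u = −t − θ(s−t)`). Hence `(φ^ε(s,x) − φ^ε(t,x))/(s−t) = G(s,x) − ε⟪𝟙K(x+·), (1+ε𝖪[s])⁻¹𝟙G(s,·)⟫`,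
which is continuous at `s = t` (§15–§17: `𝖪[s]` norm-continuous, inversion continuous at units): `∂_tφ^ε(t,x)` EXISTS at
every `x` and every clean `t > 0`, and it solves Suzuki's differentiated equation (3.20)
`∂_tφ + ε∫_{−t}^{t}K(x+y)∂_tφ(t,y)dy = K′(x+t) − εφ^ε(t,t)K(x+t)` — the first input of §3.5 towards (3.25)/(3.30). -/

section Calculus

/-- RH-FREE. `K(y+s) − K(y+t) = (s−t)∫₀¹ K′(y+t+θ(s−t))dθ` for `K ∈ C¹`. -/
theorem sub_eq_mul_integral_deriv (hKd : ContDiff ℝ 1 K) (y t s : ℝ) :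
    K (y + s) - K (y + t) = (s - t) * ∫ θ in (0:ℝ)..1, deriv K (y + t + θ * (s - t)) := by
  have hK' : Continuous (deriv K) := hKd.continuous_deriv le_rfl
  have hdiff : ∀ u : ℝ, HasDerivAt K (deriv K u) u := fun u => (hKd.differentiable one_ne_zero u).hasDerivAt
  have h : ∀ θ ∈ uIcc (0:ℝ) 1,
      HasDerivAt (fun θ : ℝ => K (y + t + θ * (s - t))) ((s - t) * deriv K (y + t + θ * (s - t))) θ := by
    intro θ _
    have h1 : HasDerivAt (fun θ : ℝ => y + t + θ * (s - t)) (s - t) θ := by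
      simpa using ((hasDerivAt_id θ).mul_const (s - t)).const_add (y + t)
    have h2 : HasDerivAt (fun θ : ℝ => K (y + t + θ * (s - t))) (deriv K (y + t + θ * (s - t)) * (s - t)) θ :=
      (hdiff (y + t + θ * (s - t))).comp θ h1
    exact h2.congr_deriv (by ring)
  have hint : IntervalIntegrable (fun θ : ℝ => (s - t) * deriv K (y + t + θ * (s - t))) volume 0 1 :=
    (continuous_const.mul (hK'.comp (by fun_prop))).intervalIntegrable _ _
  have hftc := intervalIntegral.integral_eq_sub_of_hasDerivAt h hint
  simp only [one_mul, zero_mul, add_zero] at hftc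
  rw [intervalIntegral.integral_const_mul, show y + t + (s - t) = y + s by ring] at hftc
  linarith

/-- RH-FREE. `∫_t^s f = (s−t)∫₀¹ f(t+θ(s−t))dθ` (affine substitution). -/
theorem intervalIntegral_eq_mul_integral_comp (f : ℝ → ℝ) (t s : ℝ) :
    ∫ u in t..s, f u = (s - t) * ∫ θ in (0:ℝ)..1, f (t + θ * (s - t)) := by
  rcases eq_or_ne s t with rfl | hne
  · simp
  · have h := intervalIntegral.integral_comp_mul_add (f := f) (a := 0) (b := 1) (sub_ne_zero.2 hne) t
    simp only [mul_zero, zero_add, mul_one, sub_add_cancel, smul_eq_mul] at h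
    have e : (fun θ : ℝ => f (t + θ * (s - t))) = fun θ => f ((s - t) * θ + t) := by
      funext θ; congr 1; ring
    rw [e, h, ← mul_assoc, mul_inv_cancel₀ (sub_ne_zero.2 hne), one_mul]

/-- RH-FREE. `∫_{−s}^{−t} f = (s−t)∫₀¹ f(−t−θ(s−t))dθ` (affine substitution). -/
theorem intervalIntegral_neg_eq_mul_integral_comp (f : ℝ → ℝ) (t s : ℝ) :
    ∫ u in (-s)..(-t), f u = (s - t) * ∫ θ in (0:ℝ)..1, f (-t - θ * (s - t)) := by
  rcases eq_or_ne s t with rfl | hne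
  · simp
  · have hc : s - t ≠ 0 := sub_ne_zero.2 hne
    have hc' : -(s - t) ≠ 0 := neg_ne_zero.2 hc
    have h := intervalIntegral.integral_comp_mul_add (f := f) (a := 0) (b := 1) hc' (-t)
    simp only [mul_zero, zero_add, mul_one, smul_eq_mul] at h
    rw [show -(s - t) + -t = -s by ring, intervalIntegral.integral_symm (-s) (-t)] at h
    have e : (fun θ : ℝ => f (-t - θ * (s - t))) = fun θ => f (-(s - t) * θ + -t) := by
      funext θ; congr 1; ring
    rw [e, h, inv_neg, neg_mul_neg, ← mul_assoc, mul_inv_cancel₀ hc, one_mul]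

end Calculus

/-- RH-FREE. `φ^ε(t,−t) = 0` (`K` vanishes on `(−∞,0]`). -/
theorem suzukiPhiExt_neg_self (hK0 : ∀ u : ℝ, u ≤ 0 → K u = 0) (h : ∃ X, IsSuzukiPhiSolution K ε t X) :
    suzukiPhiExt K ε t (-t) = 0 := by
  rw [suzukiPhiExt_eq h, neg_add_cancel, hK0 0 le_rfl, setIntegral_eq_zero_of_forall_eq_zero fun y hy => ?_]
  · simp
  · rw [hK0 (-t + y) (by simp only [mem_Iic] at hy; linarith), zero_mul]

/-- RH-FREE. **The difference equation:** for `s, t ≥ 0` at which (3.4) is solvable and `K ∈ C¹` vanishing on `(−∞,0]`,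
`D = φ^ε(s,·) − φ^ε(t,·)` satisfies, for every real `x`,
`D(x) + ε∫_{(−s,s)}K(x+y)D(y)dy = (s−t)·G(s,x)` with
`G(s,x) = ∫₀¹ [K′(x+t+θ(s−t)) − ε(K(x+t+θ(s−t))φ^ε(t,t+θ(s−t)) + K(x−t−θ(s−t))φ^ε(t,−t−θ(s−t)))]dθ`. -/
theorem suzukiPhiExt_sub_eq (hKd : ContDiff ℝ 1 K) (hK0 : ∀ u : ℝ, u ≤ 0 → K u = 0) {s : ℝ}
    (hsol_s : ∃ X, IsSuzukiPhiSolution K ε s X) (hsol_t : ∃ X, IsSuzukiPhiSolution K ε t X)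
    (hs : 0 ≤ s) (ht : 0 ≤ t) (x : ℝ) :
    (suzukiPhiExt K ε s x - suzukiPhiExt K ε t x) +
        ε * ∫ y in Ioo (-s) s, K (x + y) * (suzukiPhiExt K ε s y - suzukiPhiExt K ε t y) =
      (s - t) * ∫ θ in (0:ℝ)..1, (deriv K (x + t + θ * (s - t)) -
        ε * (K (x + (t + θ * (s - t))) * suzukiPhiExt K ε t (t + θ * (s - t)) +
          K (x + (-t - θ * (s - t))) * suzukiPhiExt K ε t (-t - θ * (s - t)))) := by
  have hKc : Continuous K := hKd.continuous
  have hK' : Continuous (deriv K) := hKd.continuous_deriv le_rfl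
  have hK3 : ∀ u : ℝ, u < 0 → K u = 0 := fun u hu => hK0 u hu.le
  have hφs : Continuous (suzukiPhiExt K ε s) := continuous_suzukiPhiExt hKc hK3 ε s
  have hφt : Continuous (suzukiPhiExt K ε t) := continuous_suzukiPhiExt hKc hK3 ε t
  set φs := suzukiPhiExt K ε s with hφs_def
  set φt := suzukiPhiExt K ε t with hφt_def
  -- (3.8) in window form at `s` and at `t`
  have e_s : φs x = K (x + s) - ε * ∫ y in Ioo (-s) s, K (x + y) * φs y := by
    rw [← setIntegral_Iic_kernel_mul_suzukiPhiExt_eq hK3 ε s x]; exact suzukiPhiExt_eq hsol_s x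
  have e_t : φt x = K (x + t) - ε * ∫ y in Ioo (-t) t, K (x + y) * φt y := by
    rw [← setIntegral_Iic_kernel_mul_suzukiPhiExt_eq hK3 ε t x]; exact suzukiPhiExt_eq hsol_t x
  -- the continuous integrand `f(u) = K(x+u)φ_t(u)`
  have hf : Continuous fun u : ℝ => K (x + u) * φt u := (hKc.comp (continuous_const.add continuous_id)).mul hφt
  have hfs : Continuous fun u : ℝ => K (x + u) * φs u := (hKc.comp (continuous_const.add continuous_id)).mul hφs
  -- split the window integral of the difference
  have hsplit : ∫ y in Ioo (-s) s, K (x + y) * (φs y - φt y) =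
      (∫ y in Ioo (-s) s, K (x + y) * φs y) - ∫ y in Ioo (-s) s, K (x + y) * φt y := by
    rw [← integral_sub ((hfs.integrableOn_Icc).mono_set Ioo_subset_Icc_self)
      ((hf.integrableOn_Icc).mono_set Ioo_subset_Icc_self)]
    refine setIntegral_congr_fun measurableSet_Ioo fun y _ => by ring
  -- window integrals of `f` as interval integrals
  have hIoo : ∀ r : ℝ, 0 ≤ r → ∫ y in Ioo (-r) r, K (x + y) * φt y = ∫ y in (-r)..r, K (x + y) * φt y := by
    intro r hr
    rw [intervalIntegral.integral_of_le (by linarith), setIntegral_congr_set (Ioo_ae_eq_Ioc (μ := volume))]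
  -- `∫_{−s}^{s} f − ∫_{−t}^{t} f = ∫_{−s}^{−t} f + ∫_t^s f`
  have hadj : ∫ y in (-s)..s, K (x + y) * φt y =
      (∫ y in (-s)..(-t), K (x + y) * φt y) + (∫ y in (-t)..t, K (x + y) * φt y) +
        ∫ y in t..s, K (x + y) * φt y := by
    rw [intervalIntegral.integral_add_adjacent_intervals (hf.intervalIntegrable _ _) (hf.intervalIntegrable _ _),
      intervalIntegral.integral_add_adjacent_intervals (hf.intervalIntegrable _ _) (hf.intervalIntegrable _ _)]
  -- the three substitutions
  have i1 := sub_eq_mul_integral_deriv hKd x t s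
  have i2 := intervalIntegral_eq_mul_integral_comp (fun u : ℝ => K (x + u) * φt u) t s
  have i3 := intervalIntegral_neg_eq_mul_integral_comp (fun u : ℝ => K (x + u) * φt u) t s
  -- integrability on `[0,1]` of the pieces of `G`
  have c1 : Continuous fun θ : ℝ => deriv K (x + t + θ * (s - t)) := hK'.comp (by fun_prop)
  have c2 : Continuous fun θ : ℝ => K (x + (t + θ * (s - t))) * φt (t + θ * (s - t)) :=
    (hKc.comp (by fun_prop)).mul (hφt.comp (by fun_prop))
  have c3 : Continuous fun θ : ℝ => K (x + (-t - θ * (s - t))) * φt (-t - θ * (s - t)) :=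
    (hKc.comp (by fun_prop)).mul (hφt.comp (by fun_prop))
  have hG : ∫ θ in (0:ℝ)..1, (deriv K (x + t + θ * (s - t)) -
        ε * (K (x + (t + θ * (s - t))) * φt (t + θ * (s - t)) + K (x + (-t - θ * (s - t))) * φt (-t - θ * (s - t)))) =
      (∫ θ in (0:ℝ)..1, deriv K (x + t + θ * (s - t))) -
        ε * ((∫ θ in (0:ℝ)..1, K (x + (t + θ * (s - t))) * φt (t + θ * (s - t))) +
          ∫ θ in (0:ℝ)..1, K (x + (-t - θ * (s - t))) * φt (-t - θ * (s - t))) := by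
    have i23 : IntervalIntegrable (fun θ : ℝ => ε * (K (x + (t + θ * (s - t))) * φt (t + θ * (s - t)) +
        K (x + (-t - θ * (s - t))) * φt (-t - θ * (s - t)))) volume 0 1 :=
      (continuous_const.mul (c2.add c3)).intervalIntegrable _ _
    rw [intervalIntegral.integral_sub (c1.intervalIntegrable _ _) i23,
      intervalIntegral.integral_const_mul, intervalIntegral.integral_add (c2.intervalIntegrable _ _)
        (c3.intervalIntegrable _ _)]
  rw [hG, hsplit, hIoo s hs, hadj, e_s, e_t, hIoo t ht]
  linear_combination i1 - ε * i2 - ε * i3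


/-- RH-FREE. The function `G(s,y)` of `suzukiPhiExt_sub_eq` is jointly continuous in `(s,y)` (parametric interval
integrals of a jointly continuous integrand; `K ∈ C¹`, `φ^ε(t,·)` continuous). -/
theorem continuous_uncurry_diffQuotKernel (hKd : ContDiff ℝ 1 K) (hK0 : ∀ u : ℝ, u ≤ 0 → K u = 0) (ε t : ℝ) :
    Continuous (uncurry fun s y : ℝ => ∫ θ in (0:ℝ)..1, (deriv K (y + t + θ * (s - t)) -
        ε * (K (y + (t + θ * (s - t))) * suzukiPhiExt K ε t (t + θ * (s - t)) +
          K (y + (-t - θ * (s - t))) * suzukiPhiExt K ε t (-t - θ * (s - t))))) := by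
  have hKc : Continuous K := hKd.continuous
  have hK' : Continuous (deriv K) := hKd.continuous_deriv le_rfl
  have hφt : Continuous (suzukiPhiExt K ε t) := continuous_suzukiPhiExt hKc (fun u hu => hK0 u hu.le) ε t
  have a1 : Continuous fun q : (ℝ × ℝ) × ℝ => q.1.2 + t + q.2 * (q.1.1 - t) := by fun_prop
  have a2 : Continuous fun q : (ℝ × ℝ) × ℝ => q.1.2 + (t + q.2 * (q.1.1 - t)) := by fun_prop
  have a3 : Continuous fun q : (ℝ × ℝ) × ℝ => t + q.2 * (q.1.1 - t) := by fun_prop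
  have a4 : Continuous fun q : (ℝ × ℝ) × ℝ => q.1.2 + (-t - q.2 * (q.1.1 - t)) := by fun_prop
  have a5 : Continuous fun q : (ℝ × ℝ) × ℝ => -t - q.2 * (q.1.1 - t) := by fun_prop
  have hF : Continuous (uncurry fun (p : ℝ × ℝ) (θ : ℝ) => deriv K (p.2 + t + θ * (p.1 - t)) -
      ε * (K (p.2 + (t + θ * (p.1 - t))) * suzukiPhiExt K ε t (t + θ * (p.1 - t)) +
        K (p.2 + (-t - θ * (p.1 - t))) * suzukiPhiExt K ε t (-t - θ * (p.1 - t)))) :=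
    (hK'.comp a1).sub (continuous_const.mul (((hKc.comp a2).mul (hφt.comp a3)).add
      ((hKc.comp a4).mul (hφt.comp a5))))
  exact intervalIntegral.continuous_parametric_intervalIntegral_of_continuous' (μ := volume) hF 0 1

/-- **RH-FREE · THE SLOPE FUNCTION (Lemma 3.6 by the resolvent road, `K ∈ C¹`):** at a clean window `t ≥ 0` there is
`Q(s,x)` — namely `Q(s,x) = G(s,x) − ε⟪𝟙_{[−s,s]}K(x+·), (1+ε𝖪[s])⁻¹(𝟙_{[−s,s]}G(s,·))⟫_{L²(ℝ)}` — with
(i) `s ↦ Q(s,x)` continuous at `t` within the clean windows, (ii) `φ^ε(s,x) − φ^ε(t,x) = (s−t)Q(s,x)` for every clean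
`s ≥ 0` and every real `x`, (iii) `ψ = Q(t,·)` solves Suzuki's differentiated equation (3.20):
`ψ(x) + ε∫_{(−t,t)}K(x+y)ψ(y)dy = K′(x+t) − εφ^ε(t,t)K(x+t)`. -/
theorem exists_slope_suzukiPhiExt (hKd : ContDiff ℝ 1 K) (hK0 : ∀ u : ℝ, u ≤ 0 → K u = 0) (hε : ε = 1 ∨ ε = -1)
    (ht : 0 ≤ t) (hN : NoUnitEigenvalue K t) :
    ∃ Q : ℝ → ℝ → ℝ,
      (∀ x : ℝ, ContinuousWithinAt (fun s : ℝ => Q s x) {s : ℝ | 0 ≤ s ∧ NoUnitEigenvalue K s} t) ∧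
      (∀ s : ℝ, 0 ≤ s → NoUnitEigenvalue K s → ∀ x : ℝ,
        suzukiPhiExt K ε s x - suzukiPhiExt K ε t x = (s - t) * Q s x) ∧
      (∀ x : ℝ, Q t x + ε * ∫ y in Ioo (-t) t, K (x + y) * Q t y =
        deriv K (x + t) - ε * suzukiPhiExt K ε t t * K (x + t)) := by
  have hKc : Continuous K := hKd.continuous
  have hK3 : ∀ u : ℝ, u < 0 → K u = 0 := fun u hu => hK0 u hu.le
  have hsol_t : ∃ X, IsSuzukiPhiSolution K ε t X := exists_isSuzukiPhiSolution_of_noUnitEigenvalue hKc hK0 hε hN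
  obtain ⟨G, hGdef⟩ : ∃ G : ℝ → ℝ → ℝ, G = fun s y : ℝ => ∫ θ in (0:ℝ)..1, (deriv K (y + t + θ * (s - t)) -
      ε * (K (y + (t + θ * (s - t))) * suzukiPhiExt K ε t (t + θ * (s - t)) +
        K (y + (-t - θ * (s - t))) * suzukiPhiExt K ε t (-t - θ * (s - t)))) := ⟨_, rfl⟩
  have hGc : Continuous (uncurry G) := by rw [hGdef]; exact continuous_uncurry_diffQuotKernel hKd hK0 ε t
  -- the window integral against a row as an inner product
  have hrow : ∀ (s x : ℝ) (v : Lp ℝ 2 (volume : Measure ℝ)) (f : ℝ → ℝ),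
      ((v : ℝ → ℝ) =ᵐ[volume] fun y => (Icc (-s) s).indicator f y) →
      ⟪(memLp_indicator_window (continuous_uncurry_kernel_row hKc x) s).toLp _, v⟫ =
        ∫ y in Ioo (-s) s, K (x + y) * f y := by
    intro s x v f hv
    have hg : MemLp (fun y : ℝ => (Icc (-s) s).indicator (fun y => K (x + y)) y) 2 (volume : Measure ℝ) :=
      memLp_indicator_window (continuous_uncurry_kernel_row hKc x) s
    rw [← integral_l2Kernel_mul_eq_inner (K := fun _ y : ℝ => (Icc (-s) s).indicator (fun y => K (x + y)) y)
      (x := x) hg v]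
    rw [← setIntegral_congr_set (Ioo_ae_eq_Icc (μ := (volume : Measure ℝ))).symm,
      ← integral_indicator measurableSet_Icc]
    refine integral_congr_ae ?_
    filter_upwards [hv] with y hy
    rw [hy]
    by_cases hyI : y ∈ Icc (-s) s
    · rw [indicator_of_mem hyI, indicator_of_mem hyI, indicator_of_mem hyI]
    · rw [indicator_of_notMem hyI, indicator_of_notMem hyI, zero_mul, indicator_of_notMem hyI]
  -- `(1 + ε𝖪[s])v` pointwise
  have hUapply : ∀ (s : ℝ) (v : Lp ℝ 2 (volume : Measure ℝ)),
      (((1 + ε • winOpL2 K hKc s) v : Lp ℝ 2 (volume : Measure ℝ)) : ℝ → ℝ) =ᵐ[volume]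
        fun x => v x + ε * ∫ y, winKer K s x y * (v : ℝ → ℝ) y := by
    intro s v
    have e : (1 + ε • winOpL2 K hKc s) v = v + ε • winOpL2 K hKc s v := by simp
    rw [e]
    filter_upwards [Lp.coeFn_add v (ε • winOpL2 K hKc s v), Lp.coeFn_smul ε (winOpL2 K hKc s v),
      winOpL2_spec hKc s v] with x hx1 hx2 hx3
    rw [hx1, Pi.add_apply, hx2, Pi.smul_apply, smul_eq_mul, hx3]
  refine ⟨fun s x => G s x - ε * ⟪(memLp_indicator_window (continuous_uncurry_kernel_row hKc x) s).toLp _,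
      Ring.inverse (1 + ε • winOpL2 K hKc s) ((memLp_indicator_window hGc s).toLp _)⟫, ?_, ?_, ?_⟩
  · -- (i) continuity of the slope function at `t` within the clean windows
    intro x
    have h1 : Continuous fun s : ℝ => G s x := hGc.comp (by fun_prop : Continuous fun s : ℝ => (s, x))
    have h2 := (continuousOn_toLp_indicator_window (continuous_uncurry_kernel_row hKc x)) t ht
    have h3 := (continuousOn_toLp_indicator_window hGc) t ht
    have h4 := continuousWithinAt_inverse_winOpL2 hKc hε ht hN
    have h5 := h4.clm_apply h3
    exact (h1.continuousWithinAt.sub (((h2.inner h5).const_smul ε).congr (fun s _ => by simp [smul_eq_mul])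
      (by simp [smul_eq_mul]))).mono fun s hs => hs.1
  · -- (ii) the difference identity
    intro s hs0 hNs x
    have hsol_s : ∃ X, IsSuzukiPhiSolution K ε s X := exists_isSuzukiPhiSolution_of_noUnitEigenvalue hKc hK0 hε hNs
    set U : Lp ℝ 2 (volume : Measure ℝ) →L[ℝ] Lp ℝ 2 (volume : Measure ℝ) := 1 + ε • winOpL2 K hKc s with hU
    have hUu : IsUnit U := isUnit_one_add_smul_winOpL2 hKc hε hNs
    have hDc : Continuous (uncurry fun _ y : ℝ => suzukiPhiExt K ε s y - suzukiPhiExt K ε t y) :=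
      ((continuous_suzukiPhiExt hKc hK3 ε s).sub (continuous_suzukiPhiExt hKc hK3 ε t)).comp continuous_snd
    set d : Lp ℝ 2 (volume : Measure ℝ) := (memLp_indicator_window hDc s).toLp _ with hd
    set q : Lp ℝ 2 (volume : Measure ℝ) := (memLp_indicator_window hGc s).toLp _ with hq
    have hd_ae : (d : ℝ → ℝ) =ᵐ[volume]
        fun y => (Icc (-s) s).indicator (fun y => suzukiPhiExt K ε s y - suzukiPhiExt K ε t y) y :=
      MemLp.coeFn_toLp _
    have hq_ae : (q : ℝ → ℝ) =ᵐ[volume] fun y => (Icc (-s) s).indicator (fun y => G s y) y := MemLp.coeFn_toLp _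
    have hDeq : ∀ x : ℝ, (suzukiPhiExt K ε s x - suzukiPhiExt K ε t x) +
        ε * ∫ y in Ioo (-s) s, K (x + y) * (suzukiPhiExt K ε s y - suzukiPhiExt K ε t y) = (s - t) * G s x := by
      intro x; rw [hGdef]; exact suzukiPhiExt_sub_eq hKd hK0 hsol_s hsol_t hs0 ht x
    -- `U d = (s − t)•q`
    have hUd : U d = (s - t) • q := by
      apply Lp.ext
      filter_upwards [hUapply s d, hd_ae, Lp.coeFn_smul (s - t) q, hq_ae] with x e1 e3 e4 e5
      rw [e1, e4, Pi.smul_apply, smul_eq_mul, e5]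
      have hint : ∫ y, winKer K s x y * (d : ℝ → ℝ) y =
          ∫ y, winKer K s x y * (Icc (-s) s).indicator (fun y => suzukiPhiExt K ε s y - suzukiPhiExt K ε t y) y :=
        integral_congr_ae (by filter_upwards [hd_ae] with y hy; rw [hy])
      rw [hint]
      by_cases hx : x ∈ Icc (-s) s
      · rw [e3, indicator_of_mem hx, indicator_of_mem hx, integral_winKer_mul_eq_setIntegral K hx]
        have hIoo : ∫ y in Ioo (-s) s, K (x + y) *
            (Icc (-s) s).indicator (fun y => suzukiPhiExt K ε s y - suzukiPhiExt K ε t y) y =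
            ∫ y in Ioo (-s) s, K (x + y) * (suzukiPhiExt K ε s y - suzukiPhiExt K ε t y) :=
          setIntegral_congr_fun measurableSet_Ioo fun y hy => by rw [indicator_of_mem (Ioo_subset_Icc_self hy)]
        rw [hIoo]
        exact hDeq x
      · rw [e3, indicator_of_notMem hx, indicator_of_notMem hx, integral_winKer_mul_eq_zero K hx]
        ring
    have hdR : d = (s - t) • Ring.inverse U q := by
      calc d = (Ring.inverse U * U) d := by rw [Ring.inverse_mul_cancel U hUu]; rfl
        _ = Ring.inverse U (U d) := rfl
        _ = (s - t) • Ring.inverse U q := by rw [hUd, map_smul]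
    have e := hDeq x
    rw [← hrow s x d _ hd_ae, hdR, real_inner_smul_right] at e
    linear_combination e
  · -- (iii) the differentiated equation (3.20) for `ψ = Q(t,·)`
    intro x
    set U : Lp ℝ 2 (volume : Measure ℝ) →L[ℝ] Lp ℝ 2 (volume : Measure ℝ) := 1 + ε • winOpL2 K hKc t with hU
    have hUu : IsUnit U := isUnit_one_add_smul_winOpL2 hKc hε hN
    set q : Lp ℝ 2 (volume : Measure ℝ) := (memLp_indicator_window hGc t).toLp _ with hq
    have hq_ae : (q : ℝ → ℝ) =ᵐ[volume] fun y => (Icc (-t) t).indicator (fun y => G t y) y := MemLp.coeFn_toLp _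
    set w : Lp ℝ 2 (volume : Measure ℝ) := Ring.inverse U q with hw
    have hUw : U w = q := by
      change (U * Ring.inverse U) q = q
      rw [Ring.mul_inverse_cancel U hUu]; rfl
    -- the a.e. equation for `w`
    have hw_ae : ∀ᵐ x ∂(volume : Measure ℝ),
        (w : ℝ → ℝ) x + ε * ∫ y, winKer K t x y * (w : ℝ → ℝ) y = (Icc (-t) t).indicator (fun y => G t y) x := by
      have h1 := hUapply t w
      rw [hUw] at h1
      filter_upwards [h1, hq_ae] with x e1 e2
      rw [← e1, e2]
    -- `⟪𝟙K(x+·), w⟫ = ∫_{(−t,t)} K(x+y) w(y) dy`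
    have hroww : ∀ x : ℝ, ⟪(memLp_indicator_window (continuous_uncurry_kernel_row hKc x) t).toLp _, w⟫ =
        ∫ y in Ioo (-t) t, K (x + y) * (w : ℝ → ℝ) y := by
      intro x
      refine hrow t x w (w : ℝ → ℝ) ?_
      -- `w` vanishes a.e. outside the window: from the equation (kernel integral vanishes there)
      filter_upwards [hw_ae] with y hy
      by_cases hyI : y ∈ Icc (-t) t
      · rw [indicator_of_mem hyI]
      · rw [indicator_of_notMem hyI]
        rw [indicator_of_notMem hyI, integral_winKer_mul_eq_zero K hyI, mul_zero, add_zero] at hy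
        exact hy
    -- on the window, `w = ψ` a.e.
    have hwψ : ∀ᵐ y ∂(volume.restrict (Ioo (-t) t)), (w : ℝ → ℝ) y =
        G t y - ε * ⟪(memLp_indicator_window (continuous_uncurry_kernel_row hKc y) t).toLp _, w⟫ := by
      rw [ae_restrict_iff' measurableSet_Ioo]
      filter_upwards [hw_ae] with y hy hyI
      rw [indicator_of_mem (Ioo_subset_Icc_self hyI),
        integral_winKer_mul_eq_setIntegral K (Ioo_subset_Icc_self hyI)] at hy
      rw [hroww y]
      linarith
    have hI : ∫ y in Ioo (-t) t, K (x + y) * (w : ℝ → ℝ) y = ∫ y in Ioo (-t) t, K (x + y) *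
        (G t y - ε * ⟪(memLp_indicator_window (continuous_uncurry_kernel_row hKc y) t).toLp _, w⟫) := by
      refine integral_congr_ae ?_
      filter_upwards [hwψ] with y hy
      rw [← hy]
    -- `G(t,x) = K′(x+t) − εφ(t,t)K(x+t)` (`φ(t,−t) = 0`)
    have hGt : G t x = deriv K (x + t) - ε * suzukiPhiExt K ε t t * K (x + t) := by
      rw [hGdef]
      simp only [sub_self, mul_zero, add_zero, sub_zero, intervalIntegral.integral_const, one_smul,
        suzukiPhiExt_neg_self hK0 hsol_t]
      ring
    change G t x - ε * ⟪(memLp_indicator_window (continuous_uncurry_kernel_row hKc x) t).toLp _, w⟫ +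
        ε * ∫ y in Ioo (-t) t, K (x + y) *
          (G t y - ε * ⟪(memLp_indicator_window (continuous_uncurry_kernel_row hKc y) t).toLp _, w⟫) = _
    rw [← hI, hroww x, hGt]
    ring

/-- **RH-FREE · LEMMA 3.6 (second half) WITHOUT FREDHOLM MINORS, for `K ∈ C¹(ℝ)` vanishing on `(−∞,0]`:** on a clean
range `[0,τ)`, for every `t ∈ (0,τ)` the extended solution `φ^ε(t,x)` is differentiable in `t` at EVERY real `x`,
and `ψ = ∂_tφ^ε(t,·)` solves Suzuki's differentiated equation (3.20)
`ψ(x) + ε∫_{(−t,t)}K(x+y)ψ(y)dy = K′(x+t) − εφ^ε(t,t)K(x+t)` for all `x`. (No exceptional set: `Λ = ∅` when `K ∈ C¹`;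
e.g. `K_ζ^{ω,ν}` with `νω > 2`, `…ZetaRegularity`.) -/
theorem hasDerivAt_suzukiPhiExt (hKd : ContDiff ℝ 1 K) (hK0 : ∀ u : ℝ, u ≤ 0 → K u = 0) (hε : ε = 1 ∨ ε = -1)
    {τ : ℝ} (hclean : ∀ s : ℝ, s ∈ Ico 0 τ → NoUnitEigenvalue K s) (ht : t ∈ Ioo 0 τ) :
    ∃ ψ : ℝ → ℝ,
      (∀ x : ℝ, ψ x + ε * ∫ y in Ioo (-t) t, K (x + y) * ψ y = deriv K (x + t) - ε * suzukiPhiExt K ε t t * K (x + t)) ∧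
      ∀ x : ℝ, HasDerivAt (fun s : ℝ => suzukiPhiExt K ε s x) (ψ x) t := by
  have ht0 : 0 ≤ t := ht.1.le
  have hN : NoUnitEigenvalue K t := hclean t ⟨ht0, ht.2⟩
  obtain ⟨Q, hQc, hQd, hQe⟩ := exists_slope_suzukiPhiExt hKd hK0 hε ht0 hN
  refine ⟨fun x => Q t x, hQe, fun x => ?_⟩
  rw [hasDerivAt_iff_tendsto_slope]
  have hS : {s : ℝ | 0 ≤ s ∧ NoUnitEigenvalue K s} ∈ 𝓝 t := by
    filter_upwards [Ioo_mem_nhds ht.1 ht.2] with s hs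
    exact ⟨hs.1.le, hclean s ⟨hs.1.le, hs.2⟩⟩
  have hc : ContinuousAt (fun s : ℝ => Q s x) t := (hQc x).continuousAt hS
  have h2 : Tendsto (fun s : ℝ => Q s x) (𝓝[≠] t) (𝓝 (Q t x)) := hc.tendsto.mono_left nhdsWithin_le_nhds
  refine h2.congr' ?_
  have hev : ∀ᶠ s in 𝓝[≠] t, s ∈ Ioo 0 τ := mem_nhdsWithin_of_mem_nhds (Ioo_mem_nhds ht.1 ht.2)
  filter_upwards [hev, self_mem_nhdsWithin] with s hs hne
  have hne' : s - t ≠ 0 := sub_ne_zero.2 hne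
  rw [slope_def_field, hQd s hs.1.le (hclean s ⟨hs.1.le, hs.2⟩) x, mul_div_cancel_left₀ _ hne']

/-- RH-FREE. The same with `deriv`: on a clean range, for `t ∈ (0,τ)` and `K ∈ C¹` vanishing on `(−∞,0]`,
`s ↦ φ^ε(s,x)` is differentiable at `t` for every `x` and
`∂_tφ^ε(t,x) + ε∫_{(−t,t)}K(x+y)∂_tφ^ε(t,y)dy = K′(x+t) − εφ^ε(t,t)K(x+t)` — Suzuki's (3.20). -/
theorem deriv_suzukiPhiExt_eq (hKd : ContDiff ℝ 1 K) (hK0 : ∀ u : ℝ, u ≤ 0 → K u = 0) (hε : ε = 1 ∨ ε = -1)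
    {τ : ℝ} (hclean : ∀ s : ℝ, s ∈ Ico 0 τ → NoUnitEigenvalue K s) (ht : t ∈ Ioo 0 τ) (x : ℝ) :
    DifferentiableAt ℝ (fun s : ℝ => suzukiPhiExt K ε s x) t ∧
      deriv (fun s : ℝ => suzukiPhiExt K ε s x) t +
          ε * ∫ y in Ioo (-t) t, K (x + y) * deriv (fun s : ℝ => suzukiPhiExt K ε s y) t =
        deriv K (x + t) - ε * suzukiPhiExt K ε t t * K (x + t) := by
  obtain ⟨ψ, hψ, hd⟩ := hasDerivAt_suzukiPhiExt hKd hK0 hε hclean ht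
  have e : (fun y : ℝ => deriv (fun s : ℝ => suzukiPhiExt K ε s y) t) = ψ := funext fun y => (hd y).deriv
  refine ⟨(hd x).differentiableAt, ?_⟩
  rw [(hd x).deriv]
  have e2 : (fun y : ℝ => K (x + y) * deriv (fun s : ℝ => suzukiPhiExt K ε s y) t) = fun y => K (x + y) * ψ y := by
    funext y; rw [(hd y).deriv]
  rw [e2]
  exact hψ x

end Summit.RiemannHypothesis.RiemannHypothesis.Theorems.SuzukiStructureFunctions
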